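import Mathlib
import Literature.AlgebraicGeometry.Resolution.TranscendenceDefect
import Literature.AlgebraicGeometry.Resolution.LocalBlowup
import Literature.AlgebraicGeometry.Resolution.AbhyankarMonomialUniformization
import HarnessLib

/-!
# The UNGUARDED typing `KnafKuhlmann2005_Thm11_monomial` is false (`Z = {0}`)

Route `RadicialJung`, crux `CleanModels` (stmt-ResolutionOfSingularities-15917), line `Sketch` rev 35; explicit-unit seat
`decomp-res-hand-1` g3 (hand 1, strategy «direct: unfold and discharge by name»).  HYGIENE for the dim `≥ 4` reduction of stub 7.

The Literature named fact `Literature.AlgebraicGeometry.Resolution.KnafKuhlmann2005_Thm11_monomial`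
(`Literature/AlgebraicGeometry/Resolution/AbhyankarMonomialUniformization.lean`, ✓ p792590) renders the «Moreover» clause of
Knaf–Kuhlmann 2005, Thm. 1.1 — "`X` can be chosen such that all `ζ ∈ Z` are `𝒪_{X,x}`-monomials in `{a₁,…,a_d}` for some regular
parameter system" — for EVERY element of the prescribed finite set `Z ⊆ 𝒪_P`, including `ζ = 0`.  An `𝒪`-monomial
`u · ∏ aᵢ^{μᵢ}` with `u` a unit is never `0` in a domain, so the typing is false as soon as `0 ∈ Z`; the corrected typing is
`KnafKuhlmann2005_Thm11_monomialForm` (same file, ✓ p793207: the clause for `ζ ≠ 0` only), to which the consumers were re-pointed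
(✓ p793208).  This file records the refutation in the kernel, so that the three accepted consumers of the unguarded fact
(`cleanLUAbh_of_kk05`, `cleanLUAbh_of_kk05_of_perfectField`, `hAbh_dim_of_kk05_of_perfectField`, ✓ p792985,
`Theorems/RadicialJungCleanModelsAbhyankarKK05.lean`) are known to be VACUOUS (hypothesis refuted), not conditional.

WITNESS: `k = K = ℚ`, the trivial valuation `O = ⊤` (Abhyankar: `transcendenceDefect_top`; residue field `= ℚ`, separable over
`ℚ`), `Z = {0}`.  Any `ℚ`-subalgebra `A' ⊆ ℚ` is `ℚ`, its local ring at the centre is the FIELD `ℚ` (Krull dimension `0`), so the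
promised regular system of parameters is EMPTY (`d = 0`) and the clause reads `0 = u · 1` with `u` a unit — absurd.

HONESTY: refutes only a typing slip (an unguarded `∀ z ∈ Z`); Knaf–Kuhlmann's theorem is fine and is `…_monomialForm`.  Proves nothing
about resolution of singularities in characteristic `p` or about `CleanModels`. [OURS · NEGATIVE · HYGIENE] counted 0.
-/

noncomputable section

set_option linter.dupNamespace false -- mandated namespace of this single-conjunct summit

open IsLocalRing
open Literature.AlgebraicGeometry.Resolution

namespace Summit.ResolutionOfSingularities.ResolutionOfSingularities.Theorems.CleanModels.Negative

/-- Over the trivial valuation `⊤` of a field, the local ring at the centre of ANY subring containing all inverses of its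
non-zero elements — in particular of a subfield — is everything: `locAtCentre B ⊤ = ⊤` as soon as `B = ⊤`. [folklore] -/
theorem locAtCentre_top_eq_top {K : Type*} [Field K] {B : Subring K} (hB : B = ⊤) :
    locAtCentre B (⊤ : ValuationSubring K) = ⊤ :=
  top_le_iff.mp ((le_of_eq hB.symm).trans (le_locAtCentre B ⊤))

/-- **`KnafKuhlmann2005_Thm11_monomial` (the unguarded typing) is false.**  Witness: `k = K = ℚ`, `O = ⊤`, `Z = {0}`: the
conclusion would make `0` a unit times an (empty) monomial in the field `ℚ`.  The printed theorem (Knaf–Kuhlmann 2005,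
Thm. 1.1, «Moreover» clause) concerns non-zero `ζ` and is typed correctly as `KnafKuhlmann2005_Thm11_monomialForm`.
[cite: KnafKuhlmann2005, Thm. 1.1] -/
theorem knafKuhlmann2005_Thm11_monomial_false : ¬ KnafKuhlmann2005_Thm11_monomial.{0} := by
  intro h
  -- the witness: `k = K = ℚ`, the trivial valuation, `Z = {0}`
  have hk : ∀ c : ℚ, algebraMap ℚ ℚ c ∈ (⊤ : ValuationSubring ℚ) := fun _ => trivial
  have hfg : (⊤ : IntermediateField ℚ ℚ).FG := by
    have : (⊤ : IntermediateField ℚ ℚ) = ⊥ :=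
      le_antisymm (fun x _ => (⊥ : IntermediateField ℚ ℚ).algebraMap_mem x) bot_le
    rw [this]
    exact IntermediateField.fg_bot
  have hD : transcendenceDefect ℚ (⊤ : ValuationSubring ℚ) hk = 0 := transcendenceDefect_top hk
  have hsep : @Algebra.IsSeparable ℚ (ResidueField (⊤ : ValuationSubring ℚ)) _ _
      ((residue (⊤ : ValuationSubring ℚ)).comp ((algebraMap ℚ ℚ).codRestrict _ hk)).toAlgebra := by
    letI := ((residue (⊤ : ValuationSubring ℚ)).comp ((algebraMap ℚ ℚ).codRestrict _ hk)).toAlgebra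
    refine ⟨fun x => ?_⟩
    obtain ⟨y, rfl⟩ := residue_surjective x
    have hy : y = ((algebraMap ℚ ℚ).codRestrict (⊤ : ValuationSubring ℚ) hk) (y : ℚ) := Subtype.ext rfl
    rw [hy]
    exact isSeparable_algebraMap (y : ℚ)
  obtain ⟨A', -, -, -, -, hreg, d, a, -, hdim, hmono⟩ :=
    h ℚ ℚ hfg ⊤ hk hD hsep {0} (fun _ _ => trivial)
  -- `A' = ℚ`, so the local ring at the centre is the field `ℚ`: Krull dimension `0`, hence `d = 0`
  have hA' : A'.toSubring = ⊤ := top_le_iff.mp fun x _ => A'.algebraMap_mem x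
  have htop : locAtCentre A'.toSubring (⊤ : ValuationSubring ℚ) = ⊤ := locAtCentre_top_eq_top hA'
  have hdim0 : ringKrullDim (locAtCentre A'.toSubring (⊤ : ValuationSubring ℚ)) = 0 := by
    rw [ringKrullDim_eq_of_ringEquiv ((RingEquiv.subringCongr htop).trans Subring.topEquiv)]
    exact ringKrullDim_eq_zero_of_field ℚ
  have hd : d = 0 := by
    have h' : (d : WithBot ℕ∞) = 0 := by rw [← hdim, hdim0]
    exact_mod_cast h'
  subst hd
  obtain ⟨v, μ, hv, h0⟩ := hmono 0 (Finset.mem_singleton_self 0)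
  simp only [Finset.univ_eq_empty, Finset.prod_empty, mul_one] at h0
  exact hv.ne_zero (Subtype.ext (by simpa using h0.symm))

end Summit.ResolutionOfSingularities.ResolutionOfSingularities.Theorems.CleanModels.Negative

end
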